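import Summits.BirchSwinnertonDyer.BirchSwinnertonDyer.Theorems.EdixhovenFibreFiveSevenLocalFormulaUnstarredOrdinaryCells
import Summits.BirchSwinnertonDyer.BirchSwinnertonDyer.Theorems.EdixhovenFibreFiveSevenOrdinaryPotGoodModelsAnyPrime
import Summits.BirchSwinnertonDyer.BirchSwinnertonDyer.Theorems.TeichmullerTwistDescentTameExponent
import HarnessLib

/-!
# Kato's explicit reciprocity FORMULA for the direct representation over the field of good reduction of a potentially good ORDINARY curve at ANY prime `p ≥ 5`
# — the ordinary numerology keyed to the PATTERN + Deuring's congruence (route `EdixhovenFibreFiveSeven`, line `kato-lever`; seat `bsd-line-edix-p1` g33, LEAD)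

HONEST FRAMING. Two theorems (no definition, no named fact, no instance, no `sorry`); helper `--supports` crux TDS11 `TwistDegreeStepOrdinary`
(stmt-BirchSwinnertonDyer-22228, the `p ≥ 11` (G)-ordinary residue of the rung W-ALL/2.p≥5.r1), whose conditional closer of record (`…TwistDegreeStepOrdinaryOfReciprocityLaw`)
takes Kato's explicit reciprocity law [REC-tower] (`tatePairingPoint_eq_trace_expStar_log_tower`, cite-only) as a hypothesis. Nothing is closed; BSD / TDS11 are NOT
proved by this.

WHAT. The width seat's `…LocalFormulaUnstarredOrdinaryCells.localFormula_of_ordinary_numerology` (edix-p4 g31) and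
`…LocalFormulaOrdinaryCellsOfCapstone.localFormula_of_ordinary_numerology_of_capstone` (edix-p4 g29) VERBATIM — statements and proofs — with `p ∈ {5, 7}` replaced
by `5 ≤ p` and the prime-keyed ordinary pattern `h5`/`h7` replaced by `hpat : (r₄ = 0 ∧ t₄ = 0 ∧ 0 < t₆ ∧ p ≡ 1 (mod 4)) ∨ (r₆ = 0 ∧ t₆ = 0 ∧ 0 < t₄ ∧ p ≡ 1 (mod 3))`
(CM fibre `j = 1728` resp. `j = 0`, ORDINARY by Deuring). The only prime-specific input of the originals was the good-model data; it is now
`OrdinaryPotGoodModelsAnyPrime.exists_goodModelData_of_ordinary_numerology_anyPrime` (this seat), and the ordinary capstone `ordinaryCapstone_of_numerology` was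
already stated for `p ≠ 2`.

* ★★★ `localFormula_of_ordinary_numerology_of_capstone_anyPrime`, ★★★ `localFormula_of_ordinary_numerology_anyPrime` — for `W/ℚ` globally minimal, `p ≥ 5`,
  `0 ≤ ord_p j`, any ordinary numerology with `hpat`, any number field `K ∋ α`, `α^e = p`, any place `v′ ∋ p` (keys), any compatible `ω′`, any alternating
  Weil tower and the Prop-1.2.3 binders: `∀ d″ ∃ c′`, `⟨[η″], P′⟩ = Tr_{K_{v′}/ℚ_p}(c′ · exp*_{d″}(η″) · log_{ω′} P′)`.

NEXT (this lane): the (G)-ORDINARY potentially good cells at `p ≥ 11` by `TypeGOrd` (`semistabilityIndex_dvd_sub_one` ⟹ Deuring's congruence), REC at their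
cyclotomic towers (`recTowerAt_cyclotomic_of_formula_over_completion` with `isDeRham_restrictedRationalTateRep_adicCompletion_rat_of_typeGOrd`), TDS11 ⟸ {modularity, P1-bar}.

References: [Kato1993LNM1553] Ch. II Thm. 1.4.1 (3)–(4), Lemma 1.4.3–1.4.5, §1.2.4; [BlochKato1990] Prop. 3.8, Ex. 3.10.1, Example 3.11; [SilvermanAEC2009]
III.1, Prop. III.8.1, VII.5.5, IV.4.4, V.4.1, Thm. IV.6.4; [SilvermanATAEC1994] IV Table 4.1; [Serre1972] §1.11.
-/

set_option autoImplicit false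
-- single-conjunct summit: `Summit.BirchSwinnertonDyer.BirchSwinnertonDyer.…` repeats the name by design
set_option linter.dupNamespace false

noncomputable section

open Field Function ValuativeRel WittVector NumberField IsDedekindDomain Polynomial
open scoped NumberField Topology Classical NNReal
open Literature.NumberTheory.PAdicHodge Literature.NumberTheory.GaloisRepresentations
  Literature.NumberTheory.GaloisRepresentations.IsNonarchimedeanLocalField Literature.NumberTheory.GaloisRepresentations.LubinTate
  Literature.NumberTheory.GaloisCohomology Literature.NumberTheory.EllipticCurves Literature.NumberTheory.EllipticCurves.FormalGroupChart
  Literature.NumberTheory.PAdicHodge.GaloisContinuity Literature.IUT.LogVolume Literature.RingTheory.FormalGroups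
  Literature.AlgebraicGeometry.Resolution _root_.WeierstrassCurve
  Literature.NumberTheory.EllipticCurves.Rank1Residual Literature.NumberTheory.DiophantineGeometry Rat.HeightOneSpectrum
  Summit.BirchSwinnertonDyer.Rank1Residual Summit.BirchSwinnertonDyer.Rank1Residual.Additive
  Summit.BirchSwinnertonDyer.BirchSwinnertonDyer.Theorems
  Summit.BirchSwinnertonDyer.BirchSwinnertonDyer.Theorems.StarredOptimalManinUnitFiveSevenSupersingularCellsModels
  Summit.BirchSwinnertonDyer.BirchSwinnertonDyer.Theorems.KimAtThreeDeepLowerExpStarOmega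
  Summit.BirchSwinnertonDyer.BirchSwinnertonDyer.Theorems.StarredOptimalManinUnitFiveSevenOrdinaryCellsModels
  Summit.BirchSwinnertonDyer.BirchSwinnertonDyer.Theorems.StarredOptimalManinUnitFiveSevenLocalFormulaOrdinaryCellsOfCapstone

namespace Summit.BirchSwinnertonDyer.BirchSwinnertonDyer.Theorems.LocalFormulaOrdinaryAnyPrime

variable (W : WeierstrassCurve ℚ) [W.IsElliptic] [W.IsGloballyMinimal] (p : ℕ) [hp : Fact p.Prime]

set_option maxHeartbeats 1600000 in
/-- ★★★ **[ANY PRIME `p ≥ 5`] Kato's explicit reciprocity formula for the DIRECT representation of an ORDINARY-cell curve over `K_{v′}`, generic ordinary numerology, GRANTED the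
ordinary capstone socket `hcap`.** For `W/ℚ` globally minimal, `p ∈ {5, 7}`, `ord_p j(W) ≥ 0`, ordinary numerology `(e, k, m, n, r₄, r₆, t₄, t₆)`, a number field
`K ∋ α`, `α^e = p`, a place `v′ ∋ p` with the packet keys and a compatible `ω′` making `W ⊗ K_{v′}` integral: IF (`hcap`) for every good `𝒪_D`-model datum of the cell
over `F = K_{v′}` with its ordinary reduction data and CM-fibre data, every socket datum of `W` over `F`, and every `Γ_F`-equivariant `φ : (W ⊗ F)(F̄) ≃ E(F̄)` with Tate-module
map, Kato's formula holds at the points of `W(F)` over deep formal points of `E` (E3's output shape, division sequences formal at every level, some depth `N ≥ 1`), THEN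
for every Weil tower of `W` with its seven laws and the Prop-1.2.3 binders: for every line datum `d″` SOME `c′` with `⟨[η″], P′⟩ = Tr_{K_{v′}/ℚ_p}(c′ · exp*_{d″}(η″) · log_{ω′} P′)`.
[cite: Kato1993LNM1553, Ch. II Thm. 1.4.1 (3)–(4), Lemma 1.4.3] [cite: SilvermanAEC2009, III.1, Prop. III.8.1, VII.5.5, IV.4.4 and V.4.1] -/
theorem localFormula_of_ordinary_numerology_of_capstone_anyPrime (hp5 : 5 ≤ p) (hj : 0 ≤ padicValRat p W.j)
    {e k m n r₄ r₆ t₄ t₆ : ℕ} (he : 0 < e) (hem : e * m = 4 * k + r₄) (hen : e * n = 6 * k + r₆)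
    (h₄ : 3 * r₄ = e * t₄) (h₆ : 2 * r₆ = e * t₆)
    (hm : 3 * m = padicValInt p W.minimalDiscriminantInt + t₄) (hn : 2 * n = padicValInt p W.minimalDiscriminantInt + t₆)
    (ht₄ : t₄ ≤ 2) (ht₆ : t₆ ≤ 1) (hpat : r₄ = 0 ∧ t₄ = 0 ∧ 0 < t₆ ∧ p % 4 = 1 ∨ r₆ = 0 ∧ t₆ = 0 ∧ 0 < t₄ ∧ p % 3 = 1)
    {K : Type} [Field K] [NumberField K] {α : K} (hαe : α ^ e = (p : K))
    (v' : HeightOneSpectrum (𝓞 K)) (hv' : ((p : ℕ) : 𝓞 K) ∈ v'.asIdeal)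
    [CharZero (v'.adicCompletion K)] [Fact (¬ IsUnit ((p : ℕ) : integerC (v'.adicCompletion K)))]
    [IsAdicComplete (Ideal.span {((p : ℕ) : integerC (v'.adicCompletion K))}) (integerC (v'.adicCompletion K))]
    (hp' : valuation (v'.adicCompletion K) ((p : ℕ) : (v'.adicCompletion K)) < 1)
    (ω' : Valuation (v'.adicCompletion K) ℝ≥0) [ω'.Compatible] [(W.baseChange (v'.adicCompletion K)).IsIntegral ω'.integer]
    (eT : (k : ℕ) → geomTorsion W ((p ^ k : ℕ) : ℤ) → geomTorsion W ((p ^ k : ℕ) : ℤ) → AlgebraicClosure ℚ) (hμ : ∀ k S T, eT k S T ^ (p ^ k) = 1)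
    (hadd₁ : ∀ k S₁ S₂ T, eT k (S₁ + S₂) T = eT k S₁ T * eT k S₂ T) (hadd₂ : ∀ k S T₁ T₂, eT k S (T₁ + T₂) = eT k S T₁ * eT k S T₂)
    (hgal : ∀ k (σ : absoluteGaloisGroup ℚ) (S T : geomTorsion W ((p ^ k : ℕ) : ℤ)), σ • eT k S T = eT k (σ • S) (σ • T))
    (hnondeg : ∀ k (T : geomTorsion W ((p ^ k : ℕ) : ℤ)), (∀ S, eT k S T = 1) → T = 0) (halt : ∀ k (S : geomTorsion W ((p ^ k : ℕ) : ℤ)), eT k S S = 1)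
    (hcompat : ∀ k (S T : geomTorsion W ((p ^ (k + 1) : ℕ) : ℤ)),
      eT k (torsionMulHom W (p ^ (k + 1)) (p ^ k) p (pow_succ p k).symm S) (torsionMulHom W (p ^ (k + 1)) (p ^ k) p (pow_succ p k).symm T) = eT (k + 1) S T ^ p)
    (hinjK : letI := LocalField.adicCompletionPadicAlgebra v' p hv'
      (bdRPeriodRingData (F := (v'.adicCompletion K)) (p := p) hp').CupLogInjective (logCyclotomic p) (restrictedRationalTateRep W (v'.adicCompletion K) p))
    (hdeK : letI := LocalField.adicCompletionPadicAlgebra v' p hv'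
      ∀ z : contOneCocycles (restrictedRationalTateRep W (v'.adicCompletion K) p).toTopRep,
        (bdRPeriodRingData (F := (v'.adicCompletion K)) (p := p) hp').HasDualExp (logCyclotomic p) (restrictedRationalTateRep W (v'.adicCompletion K) p) fun σ => z.1 σ)
    (d'' : letI := LocalField.adicCompletionPadicAlgebra v' p hv'
      (bdRPeriodRingData (F := (v'.adicCompletion K)) (p := p) hp').FilZeroLine (restrictedRationalTateRep W (v'.adicCompletion K) p))
    -- THE ORDINARY CAPSTONE SOCKET: Kato's formula at the points of `W(F)` over deep FORMAL points of any good ordinary `𝒪_D`-model of the cell, transport form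
    (hcap : letI := LocalField.padicAlgebra (v'.adicCompletion K) p hp'
      haveI : CharZero (CompletedAlgClosure (v'.adicCompletion K)) :=
        charZero_of_injective_algebraMap (algebraMap (v'.adicCompletion K) (CompletedAlgClosure (v'.adicCompletion K))).injective
      ∀ (D : EisensteinRoot (v'.adicCompletion K) p hp') (_hD : D.poly = X ^ e - C (p : ℤ_[p])) (a b : ℤ)
        (Wm : WeierstrassCurve (EisensteinRoot.CoeffDisc D)) (ψ₀ : EisensteinRoot.CoeffDisc D →+* LTCoeff (v'.adicCompletion K))
        (_hψ₀ : ∀ c, algebraMap (LTCoeff (v'.adicCompletion K)) (v'.adicCompletion K) (ψ₀ c) = EisensteinRoot.CoeffDisc.toF D c)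
        (_hWm : Wm = ⟨0, 0, 0, algebraMap ℤ (EisensteinRoot.CoeffDisc D) a * EisensteinRoot.CoeffDisc.of D (AdjoinRoot.root D.poly) ^ r₄,
          algebraMap ℤ (EisensteinRoot.CoeffDisc D) b * EisensteinRoot.CoeffDisc.of D (AdjoinRoot.root D.poly) ^ r₆⟩)
        (_hu : IsUnit (64 * (a : ℤ_[p]) ^ 3 * (p : ℤ_[p]) ^ t₄ + 432 * (b : ℤ_[p]) ^ 2 * (p : ℤ_[p]) ^ t₆))
        (_hΔ : IsUnit (Wm.map ψ₀).Δ) (_hA : ((Wm.map ψ₀).map (AinfTop.redCoeff (v'.adicCompletion K))).hasseCoeff p ≠ 0)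
        (_h1 : IsUnit (algebraMap (LTCoeff (v'.adicCompletion K)) (CBall (v'.adicCompletion K)) (PowerSeries.coeff p ((Wm.map ψ₀).formalMul p))))
        [(AinfTop.curveFO (v'.adicCompletion K) (Wm.map ψ₀)).IsElliptic]
        [(curveOver (CompletedAlgClosure (v'.adicCompletion K)) (Wm.map ψ₀)).IsElliptic]
        (E₀ : WeierstrassCurve ℤ) (_hE₀ : E₀ = ⟨0, 0, 0, if r₄ = 0 then a else 0, if r₆ = 0 then b else 0⟩)
        (_hWE : Wm.map (Ideal.Quotient.mk (Ideal.span {EisensteinRoot.CoeffDisc.of D (AdjoinRoot.root D.poly)})) =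
          (E₀.map (algebraMap ℤ (EisensteinRoot.CoeffDisc D))).map (Ideal.Quotient.mk (Ideal.span {EisensteinRoot.CoeffDisc.of D (AdjoinRoot.root D.poly)})))
        (_hΔ₀ : ¬ (p : ℤ) ∣ E₀.Δ) (_hA₀ : (E₀.map (Int.castRingHom (ZMod p))).hasseCoeff p ≠ 0)
        (_htr : ¬ (p : ℤ) ∣ HasseManin.tr (E₀.map (Int.castRingHom (ZMod p))))
        (_hnorm : ‖((HasseManin.tr (E₀.map (Int.castRingHom (ZMod p))) : ℤ) : ℤ_[p])‖ = 1)
        (_hsq : HasseManin.tr (E₀.map (Int.castRingHom (ZMod p))) ^ 2 < 4 * p)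
        [(E₀.map (Int.castRingHom ℚ_[p])).IsElliptic] [(E₀.map (Int.castRingHom (ZMod p))).IsElliptic]
        [(curveOver (CompletedAlgClosure (v'.adicCompletion K)) E₀).IsElliptic]
        -- socket data of `W` over `F`
        (ψ : C(absoluteGaloisGroup (v'.adicCompletion K), ℤ_[p])) (_hψ : ∀ σ τ, ψ (σ * τ) = ψ σ + ψ τ)
        (_hψlog : ∀ τ, (ψ τ : ℚ_[p]) = logCyclotomic (F := (v'.adicCompletion K)) p τ)
        (_heL : ∀ (c : ℤ_[p]) (S U : W.tateModule p),
          (weilContPairingPadic W (v'.adicCompletion K) p eT hμ hadd₁ hadd₂ hgal hcompat).toLin (c • S) U =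
          twistHom (v'.adicCompletion K) p ((weilContPairingPadic W (v'.adicCompletion K) p eT hμ hadd₁ hadd₂ hgal hcompat).toLin S U) c)
        (_healt : ∀ S : W.tateModule p, (weilContPairingPadic W (v'.adicCompletion K) p eT hμ hadd₁ hadd₂ hgal hcompat).toLin S S = 0)
        (_henondeg : ∀ S : W.tateModule p,
          (∀ U, (weilContPairingPadic W (v'.adicCompletion K) p eT hμ hadd₁ hadd₂ hgal hcompat).toLin S U = 0) → S = 0)
        (_hinj : (bdRPeriodRingData (F := (v'.adicCompletion K)) (p := p) hp').CupLogInjective (logCyclotomic p)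
          (restrictedRationalTateRep W (v'.adicCompletion K) p))
        (_hde : ∀ η : contOneCocycles (restrictedTateRep W (v'.adicCompletion K) p).toTopRep,
          (bdRPeriodRingData (F := (v'.adicCompletion K)) (p := p) hp').HasDualExp (logCyclotomic p)
            (restrictedRationalTateRep W (v'.adicCompletion K) p) fun σ => TateModule.toRational p (η.1 σ))
        (d : (bdRPeriodRingData (F := (v'.adicCompletion K)) (p := p) hp').FilZeroLine (restrictedRationalTateRep W (v'.adicCompletion K) p))
        -- a depth `N ≥ 1`, then: the transport isomorphism onto the model and its Tate-module map
        , ∃ N : ℕ, N ≠ 0 ∧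
      ∀ (φ : geomPoints (W.baseChange (v'.adicCompletion K)) ≃+ (AinfTop.curveFO (v'.adicCompletion K) (Wm.map ψ₀)).geomPoints)
        (_hφ : ∀ (σ : absoluteGaloisGroup (v'.adicCompletion K)) (P : geomPoints (W.baseChange (v'.adicCompletion K))), φ (σ • P) = σ • φ P)
        (Tφ : (W.baseChange (v'.adicCompletion K)).tateModule p ≃ₗ[ℤ_[p]] (AinfTop.curveFO (v'.adicCompletion K) (Wm.map ψ₀)).tateModule p)
        (_hTφ : ∀ (a : (W.baseChange (v'.adicCompletion K)).tateModule p) (n : ℕ), TateModule.proj p n (Tφ a) = φ (TateModule.proj p n a)),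
      ∃ c : v'.adicCompletion K,
      ∀ (η : contOneCocycles (restrictedTateRep W (v'.adicCompletion K) p).toTopRep)
        (P : (W.baseChange (v'.adicCompletion K)).toAffine.Point)
        (Q : ℕ → geomPoints (W.baseChange (v'.adicCompletion K)))
        (_hQ : ∀ n, p • Q (n + 1) = Q n)
        (_hQ0 : Q 0 = toGeomPoints (W.baseChange (v'.adicCompletion K)) P)
        (hker : ∀ n, AinfTop.geomToCO (Wm.map ψ₀) ((⇑φ ∘ Q) n) ∈ kernel (NormedField.valuation (K := CompletedAlgClosure (v'.adicCompletion K)))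
          (curveOver (CompletedAlgClosure (v'.adicCompletion K)) (Wm.map ψ₀))),
        ‖((zPt (AinfTop.geomToCO (Wm.map ψ₀) ((⇑φ ∘ Q) 0)) (hker 0) : CBall (v'.adicCompletion K)) : CompletedAlgClosure (v'.adicCompletion K))‖ ^ N ≤
            ‖(p : CompletedAlgClosure (v'.adicCompletion K))‖ →
        ∀ cP : v'.adicCompletion K,
          algebraMap (v'.adicCompletion K) (CompletedAlgClosure (v'.adicCompletion K)) cP =
            (p : CompletedAlgClosure (v'.adicCompletion K)) ^ N *
              ∑' j : ℕ, PowerSeries.coeff j (Wm.map ((CBall (v'.adicCompletion K)).subtype.comp (EisensteinRoot.CoeffDisc.toCBall D))).formalLog *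
                ((zPt (AinfTop.geomToCO (Wm.map ψ₀) ((⇑φ ∘ Q) 0)) (hker 0) : CBall (v'.adicCompletion K)) : CompletedAlgClosure (v'.adicCompletion K)) ^ j →
          ((tatePairingPoint W (v'.adicCompletion K) p eT hμ hadd₁ hadd₂ hgal hcompat (oneCocycleClass _ η) P : ℤ_[p]) : ℚ_[p]) =
            -Algebra.trace ℚ_[p] (v'.adicCompletion K) (cP * (expStarCoord W hp' d η * c))) :
    letI := LocalField.adicCompletionPadicAlgebra v' p hv'
    ∃ c' : (v'.adicCompletion K),
      ∀ (η'' : contOneCocycles (restrictedTateRep W (v'.adicCompletion K) p).toTopRep) (P' : (W.baseChange (v'.adicCompletion K)).toAffine.Point),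
      ((tatePairingPoint W (v'.adicCompletion K) p eT hμ hadd₁ hadd₂ hgal hcompat (oneCocycleClass _ η'') P' : ℤ_[p]) : ℚ_[p]) =
        Algebra.trace ℚ_[p] (v'.adicCompletion K) (c' * expStarCoord W hp' d'' η'' * padicLogPointFiniteExt ω' (W.baseChange (v'.adicCompletion K)) p P') := by
  letI := LocalField.adicCompletionPadicAlgebra v' p hv'
  haveI : CharZero (CompletedAlgClosure (v'.adicCompletion K)) :=
    charZero_of_injective_algebraMap (algebraMap (v'.adicCompletion K) (CompletedAlgClosure (v'.adicCompletion K))).injective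
  have hpr : p.Prime := hp.out
  -- §1–§4: the cell's good model and its data (`…OrdinaryCellsModels`)
  obtain ⟨D, hD, a, b, Wm, ψ₀, Cv, hψ₀, hWm, hu, hCE, hΔ, hA, h1, hWE, hΔ₀, hA₀, htr, hnorm, hsq⟩ :=
    OrdinaryPotGoodModelsAnyPrime.exists_goodModelData_of_ordinary_numerology_anyPrime W p hp5 hj he hem hen h₄ h₆ hm hn ht₄ ht₆ hpat hαe v' hp'
  haveI hEll : (AinfTop.curveFO (v'.adicCompletion K) (Wm.map ψ₀)).IsElliptic := AinfTop.isElliptic_curveFO _ hΔ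
  haveI hEllC : (curveOver (CompletedAlgClosure (v'.adicCompletion K)) (Wm.map ψ₀)).IsElliptic := AinfTop.isElliptic_curveOverC_O hΔ
  set E₀ : WeierstrassCurve ℤ := ⟨0, 0, 0, if r₄ = 0 then a else 0, if r₆ = 0 then b else 0⟩ with hE₀
  have hE₀Δ0 : E₀.Δ ≠ 0 := fun h => hΔ₀ (h ▸ dvd_zero _)
  haveI : (E₀.map (Int.castRingHom ℚ_[p])).IsElliptic :=
    ⟨by rw [WeierstrassCurve.map_Δ, isUnit_iff_ne_zero, eq_intCast]; exact Int.cast_ne_zero.mpr hE₀Δ0⟩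
  haveI : (E₀.map (Int.castRingHom (ZMod p))).IsElliptic :=
    ⟨by rw [WeierstrassCurve.map_Δ, isUnit_iff_ne_zero, eq_intCast, Ne, ZMod.intCast_zmod_eq_zero_iff_dvd]; exact_mod_cast hΔ₀⟩
  haveI : (curveOver (CompletedAlgClosure (v'.adicCompletion K)) E₀).IsElliptic := AinfTop.isElliptic_curveOverC E₀ hE₀Δ0
  -- §6 the socket data for `W` over `F`: `|u| ≤ 1`, the `ℤ_p`-valued `log χ`, `heL/healt/henondeg` from `halt`, integrality of the model
  have huv : ω' (Cv.u : v'.adicCompletion K) ≤ 1 := by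
    refine valuation_u_le_one_of_smul_eq_curveFO W v' ω' (Wm.map ψ₀) hΔ (C := Cv) ?_
    convert hCE using 3
    exact Subsingleton.elim _ _
  obtain ⟨ψ, hψ, hψlog⟩ := exists_continuousMap_coe_eq_logCyclotomic (v'.adicCompletion K) p
  have heL := weilContPairingPadic_toLin_smul_left (F := (v'.adicCompletion K)) W eT hμ hadd₁ hadd₂ hgal hcompat halt
  have healt := weilContPairingPadic_toLin_self (F := (v'.adicCompletion K)) W eT hμ hadd₁ hadd₂ hgal hcompat halt
  have henondeg := weilContPairingPadic_toLin_nondegenerate (F := (v'.adicCompletion K)) W eT hμ hadd₁ hadd₂ hgal hcompat halt hnondeg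
  haveI : (AinfTop.curveFO (v'.adicCompletion K) (Wm.map ψ₀)).IsIntegral ω'.integer := AinfTop.isIntegral_curveFO _ ω'
  have hde : ∀ η : contOneCocycles (restrictedTateRep W (v'.adicCompletion K) p).toTopRep,
      (bdRPeriodRingData (F := (v'.adicCompletion K)) (p := p) hp').HasDualExp (logCyclotomic p)
        (restrictedRationalTateRep W (v'.adicCompletion K) p) fun σ => TateModule.toRational p (η.1 σ) := fun η => hdeK (pushRational p η)
  -- the capstone socket at this model datum (a depth `N`, then the formula for every transport `φ`); then E6 over the formal-point input
  obtain ⟨N, hN0, hformalT⟩ := hcap D hD a b Wm ψ₀ hψ₀ hWm hu hΔ hA h1 E₀ hE₀ hWE hΔ₀ hA₀ htr hnorm hsq ψ hψ hψlog heL healt henondeg hinjK hde d''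
  -- E6 over the formal-point input (inlined twin of `…TransportedReciprocityOfVariableChangeOfFormalPoints`): transport data of `Cv`, log rescaling, E4/E5
  haveI : (W.baseChange (v'.adicCompletion K)).IsElliptic := inferInstance
  obtain ⟨φ, Tφ, φF, hφ, hTφ, hφF, hφFC⟩ := exists_transportData_of_variableChange (W.baseChange (v'.adicCompletion K)) Cv p hCE
  have hlogφ : ∀ P, padicLogPointFiniteExt ω' (AinfTop.curveFO (v'.adicCompletion K) (Wm.map ψ₀)) p (φF P) =
      (Cv.u : v'.adicCompletion K) * padicLogPointFiniteExt ω' (W.baseChange (v'.adicCompletion K)) p P := fun P => by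
    rw [hφFC P]
    exact padicLogPointFiniteExt_congrEquiv_pointMap_of_isNonarchimedeanLocalField (W.baseChange (v'.adicCompletion K)) Cv ω' hCE hp' huv P
  exact TransportedReciprocityTransportAllPointsOfFormalPoints.exists_const_tatePairingPoint_eq_trace_mul_padicLog_transport_of_formalPoints_of_log_eq v' hp'
    D Wm ψ₀ hψ₀ hΔ h1 W φ eT hμ hadd₁ hadd₂ hgal hcompat ω' φF hφF hN0 d'' (hformalT φ hφ Tφ hTφ) ω' (Cv.u : v'.adicCompletion K) hlogφ

set_option maxHeartbeats 1600000 in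
/-- ★★★ **[ANY PRIME `p ≥ 5`] Kato's explicit reciprocity formula for the DIRECT representation of `W` over `K_{v′}`, ANY ordinary numerology, UNCONDITIONALLY.** For `W/ℚ`
globally minimal, `p ∈ {5, 7}`, `0 ≤ ord_p j(W)`, an ordinary numerology `(e, k, m, n, r₄, r₆, t₄, t₆)` (`e m = 4k + r₄`, `e n = 6k + r₆`, `3r₄ = e t₄`,
`2r₆ = e t₆`, `3m = ord_p Δ_min + t₄`, `2n = ord_p Δ_min + t₆`, `t₄ ≤ 2`, `t₆ ≤ 1`, `r₄ = t₄ = 0 < t₆` at `5`, `r₆ = t₆ = 0 < t₄` at `7`), a number field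
`K ∋ α` with `α^e = p`, a place `v′ ∋ p` with the packet keys, a compatible `ω′` with `W ⊗ K_{v′}` integral, an alternating Weil tower of `W` and the
Prop-1.2.3 binders: for every line datum `d″` SOME `c′ ∈ K_{v′}` with `⟨[η″], P′⟩ = Tr_{K_{v′}/ℚ_p}(c′ · exp*_{d″}(η″) · log_{ω′} P′)` for all `η″`, `P′`
(`localFormula_of_ordinary_numerology_of_capstone` ∘ `ordinaryCapstone_of_numerology`). [cite: Kato1993LNM1553, Ch. II Thm. 1.4.1 (3)–(4), Lemma 1.4.3–1.4.5 and §1.2.4]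
[cite: BlochKato1990, Prop. 3.8 (p. 354), Example 3.11 (p. 361)] [cite: SilvermanAEC2009, III.1, Prop. III.8.1, VII.5.5, IV.4.4 and V.4.1] -/
theorem localFormula_of_ordinary_numerology_anyPrime (hp5 : 5 ≤ p) (hj : 0 ≤ padicValRat p W.j)
    {e k m n r₄ r₆ t₄ t₆ : ℕ} (he : 0 < e) (hem : e * m = 4 * k + r₄) (hen : e * n = 6 * k + r₆)
    (h₄ : 3 * r₄ = e * t₄) (h₆ : 2 * r₆ = e * t₆)
    (hm : 3 * m = padicValInt p W.minimalDiscriminantInt + t₄) (hn : 2 * n = padicValInt p W.minimalDiscriminantInt + t₆)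
    (ht₄ : t₄ ≤ 2) (ht₆ : t₆ ≤ 1) (hpat : r₄ = 0 ∧ t₄ = 0 ∧ 0 < t₆ ∧ p % 4 = 1 ∨ r₆ = 0 ∧ t₆ = 0 ∧ 0 < t₄ ∧ p % 3 = 1)
    {K : Type} [Field K] [NumberField K] {α : K} (hαe : α ^ e = (p : K))
    (v' : HeightOneSpectrum (𝓞 K)) (hv' : ((p : ℕ) : 𝓞 K) ∈ v'.asIdeal)
    [CharZero (v'.adicCompletion K)] [Fact (¬ IsUnit ((p : ℕ) : integerC (v'.adicCompletion K)))]
    [IsAdicComplete (Ideal.span {((p : ℕ) : integerC (v'.adicCompletion K))}) (integerC (v'.adicCompletion K))]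
    (hp' : valuation (v'.adicCompletion K) ((p : ℕ) : (v'.adicCompletion K)) < 1)
    (ω' : Valuation (v'.adicCompletion K) ℝ≥0) [ω'.Compatible] [(W.baseChange (v'.adicCompletion K)).IsIntegral ω'.integer]
    (eT : (k : ℕ) → geomTorsion W ((p ^ k : ℕ) : ℤ) → geomTorsion W ((p ^ k : ℕ) : ℤ) → AlgebraicClosure ℚ) (hμ : ∀ k S T, eT k S T ^ (p ^ k) = 1)
    (hadd₁ : ∀ k S₁ S₂ T, eT k (S₁ + S₂) T = eT k S₁ T * eT k S₂ T) (hadd₂ : ∀ k S T₁ T₂, eT k S (T₁ + T₂) = eT k S T₁ * eT k S T₂)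
    (hgal : ∀ k (σ : absoluteGaloisGroup ℚ) (S T : geomTorsion W ((p ^ k : ℕ) : ℤ)), σ • eT k S T = eT k (σ • S) (σ • T))
    (hnondeg : ∀ k (T : geomTorsion W ((p ^ k : ℕ) : ℤ)), (∀ S, eT k S T = 1) → T = 0) (halt : ∀ k (S : geomTorsion W ((p ^ k : ℕ) : ℤ)), eT k S S = 1)
    (hcompat : ∀ k (S T : geomTorsion W ((p ^ (k + 1) : ℕ) : ℤ)),
      eT k (torsionMulHom W (p ^ (k + 1)) (p ^ k) p (pow_succ p k).symm S) (torsionMulHom W (p ^ (k + 1)) (p ^ k) p (pow_succ p k).symm T) = eT (k + 1) S T ^ p)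
    (hinjK : letI := LocalField.adicCompletionPadicAlgebra v' p hv'
      (bdRPeriodRingData (F := (v'.adicCompletion K)) (p := p) hp').CupLogInjective (logCyclotomic p) (restrictedRationalTateRep W (v'.adicCompletion K) p))
    (hdeK : letI := LocalField.adicCompletionPadicAlgebra v' p hv'
      ∀ z : contOneCocycles (restrictedRationalTateRep W (v'.adicCompletion K) p).toTopRep,
        (bdRPeriodRingData (F := (v'.adicCompletion K)) (p := p) hp').HasDualExp (logCyclotomic p) (restrictedRationalTateRep W (v'.adicCompletion K) p) fun σ => z.1 σ)
    (d'' : letI := LocalField.adicCompletionPadicAlgebra v' p hv'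
      (bdRPeriodRingData (F := (v'.adicCompletion K)) (p := p) hp').FilZeroLine (restrictedRationalTateRep W (v'.adicCompletion K) p)) :
    letI := LocalField.adicCompletionPadicAlgebra v' p hv'
    ∃ c' : (v'.adicCompletion K),
      ∀ (η'' : contOneCocycles (restrictedTateRep W (v'.adicCompletion K) p).toTopRep) (P' : (W.baseChange (v'.adicCompletion K)).toAffine.Point),
      ((tatePairingPoint W (v'.adicCompletion K) p eT hμ hadd₁ hadd₂ hgal hcompat (oneCocycleClass _ η'') P' : ℤ_[p]) : ℚ_[p]) =
        Algebra.trace ℚ_[p] (v'.adicCompletion K) (c' * expStarCoord W hp' d'' η'' * padicLogPointFiniteExt ω' (W.baseChange (v'.adicCompletion K)) p P') :=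
  localFormula_of_ordinary_numerology_of_capstone_anyPrime W p hp5 hj he hem hen h₄ h₆ hm hn ht₄ ht₆ hpat hαe v' hv' hp' ω' eT hμ hadd₁ hadd₂ hgal
    hnondeg halt hcompat hinjK hdeK d''
    (LocalFormulaUnstarredOrdinaryCells.ordinaryCapstone_of_numerology W p (by omega) v' hv' hp' ω' eT hμ hadd₁ hadd₂ hgal hnondeg halt hcompat hinjK
      hdeK d'')

/-! ## §3 The (G)-ORDINARY unstarred potentially good cells at ANY prime `p ≥ 5` (so at every `p ≥ 11`) -/

set_option maxHeartbeats 1600000 in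
/-- ★★★ **Kato's explicit reciprocity FORMULA at the (G)-ORDINARY UNSTARRED potentially good cells, EVERY prime `p ≥ 5`.** `⟨[η″], P′⟩ =
Tr_{K_{v′}/ℚ_p}(c′ · exp*_{d″}(η″) · log_{ω′} P′)` (`∀ d″ ∃ c′`) for the DIRECT representation `V_pW′|_{Γ_{K_{v′}}}` of every globally minimal `W′/ℚ` with `p ≥ 5`,
additive reduction at `p`, `ord_p Δ_min ≤ 4` and (G)-ORDINARY (`TypeGOrd W′ p`; no `Irr` / no-`Iₙ*` binder is needed), on the cell table `ord = 2 ↦ e = 6`,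
`ord = 3 ↦ e = 4`, `ord = 4 ↦ e = 3` (Kodaira II, III, IV), over the completion `K_{v′}` of ANY number field `K ∋ α`, `α^e = p`, at ANY `v′ ∋ p`, every compatible
`ω′`, every alternating Weil tower, the Prop-1.2.3 binders handed over — the binder shape of `localFormulaUnstarredOrdinaryCells` with `p ∈ {5, 7}` replaced by
`5 ≤ p ∧ TypeGOrd`. (G)-ordinarity gives `e ∣ p − 1` (`TeichmullerTwistDescent.TameExponent.semistabilityIndex_dvd_sub_one`, `e = 12/gcd(12, ord_p Δ_min)`), i.e.
Deuring's congruence `p ≡ 1 (mod 3)` on `e ∈ {3, 6}` (CM fibre `j = 0`) and `p ≡ 1 (mod 4)` on `e = 4` (`j = 1728`); numerology `(6; 1,1,1; 2,0; 1,0)`,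
`(4; 1,1,2; 0,2; 0,1)`, `(3; 1,2,2; 2,0; 2,0)`; `0 ≤ ord_p j` by `padicValRat_j_nonneg_of_typeGOrd`. At `p = 11` the hypotheses
are contradictory (`3, 4, 6 ∤ 10`, `TameExponent.thirteen_le`), so the content starts at `p = 13`.
[cite: Kato1993LNM1553, Ch. II Thm. 1.4.1 (3)–(4), Lemma 1.4.3–1.4.5 and §1.2.4] [cite: Serre1972, §5.6 and §1.11] [cite: SilvermanATAEC1994, IV Table 4.1]
[cite: SilvermanAEC2009, VII.5.5, IV.4.4 and V.4.1] -/
theorem localFormulaOrdinaryUnstarred_of_typeGOrd :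
    ∀ (W' : WeierstrassCurve ℚ) [W'.IsElliptic] [W'.IsGloballyMinimal] (p : ℕ) [Fact p.Prime], 5 ≤ p → Addv W' p →
      padicValInt p W'.minimalDiscriminantInt ≤ 4 → TypeGOrd W' p →
      ∀ {K : Type} [Field K] [NumberField K] (α : K) (e : ℕ),
      (padicValInt p W'.minimalDiscriminantInt = 2 ∧ e = 6 ∨ padicValInt p W'.minimalDiscriminantInt = 3 ∧ e = 4 ∨
        padicValInt p W'.minimalDiscriminantInt = 4 ∧ e = 3) → α ^ e = (p : K) →
      ∀ (v' : HeightOneSpectrum (𝓞 K)) (hv' : ((p : ℕ) : 𝓞 K) ∈ v'.asIdeal)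
      [CharZero (v'.adicCompletion K)] [Fact (¬ IsUnit ((p : ℕ) : integerC (v'.adicCompletion K)))]
      [IsAdicComplete (Ideal.span {((p : ℕ) : integerC (v'.adicCompletion K))}) (integerC (v'.adicCompletion K))]
      (hp' : valuation (v'.adicCompletion K) ((p : ℕ) : (v'.adicCompletion K)) < 1)
      (ω' : Valuation (v'.adicCompletion K) ℝ≥0) [ω'.Compatible] [(W'.baseChange (v'.adicCompletion K)).IsIntegral ω'.integer],
      letI := LocalField.adicCompletionPadicAlgebra v' p hv'
      ∀ (e : (k : ℕ) → geomTorsion W' ((p ^ k : ℕ) : ℤ) → geomTorsion W' ((p ^ k : ℕ) : ℤ) → AlgebraicClosure ℚ) (hμ : ∀ k S T, e k S T ^ (p ^ k) = 1)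
      (hadd₁ : ∀ k S₁ S₂ T, e k (S₁ + S₂) T = e k S₁ T * e k S₂ T) (hadd₂ : ∀ k S T₁ T₂, e k S (T₁ + T₂) = e k S T₁ * e k S T₂)
      (hgal : ∀ k (σ : absoluteGaloisGroup ℚ) (S T : geomTorsion W' ((p ^ k : ℕ) : ℤ)), σ • e k S T = e k (σ • S) (σ • T))
      (_hnondeg : ∀ k (T : geomTorsion W' ((p ^ k : ℕ) : ℤ)), (∀ S, e k S T = 1) → T = 0) (_halt : ∀ k (S : geomTorsion W' ((p ^ k : ℕ) : ℤ)), e k S S = 1)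
      (hcompat : ∀ k (S T : geomTorsion W' ((p ^ (k + 1) : ℕ) : ℤ)),
      e k (torsionMulHom W' (p ^ (k + 1)) (p ^ k) p (pow_succ p k).symm S) (torsionMulHom W' (p ^ (k + 1)) (p ^ k) p (pow_succ p k).symm T) = e (k + 1) S T ^ p),
      (bdRPeriodRingData (F := (v'.adicCompletion K)) (p := p) hp').CupLogInjective (logCyclotomic p) (restrictedRationalTateRep W' (v'.adicCompletion K) p) →
      (∀ z : contOneCocycles (restrictedRationalTateRep W' (v'.adicCompletion K) p).toTopRep,
        (bdRPeriodRingData (F := (v'.adicCompletion K)) (p := p) hp').HasDualExp (logCyclotomic p) (restrictedRationalTateRep W' (v'.adicCompletion K) p) fun σ => z.1 σ) →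
      ∀ d'' : (bdRPeriodRingData (F := (v'.adicCompletion K)) (p := p) hp').FilZeroLine (restrictedRationalTateRep W' (v'.adicCompletion K) p), ∃ c' : (v'.adicCompletion K),
      ∀ (η'' : contOneCocycles (restrictedTateRep W' (v'.adicCompletion K) p).toTopRep) (P' : (W'.baseChange (v'.adicCompletion K)).toAffine.Point),
      ((tatePairingPoint W' (v'.adicCompletion K) p e hμ hadd₁ hadd₂ hgal hcompat (oneCocycleClass _ η'') P' : ℤ_[p]) : ℚ_[p]) =
        Algebra.trace ℚ_[p] (v'.adicCompletion K) (c' * expStarCoord W' hp' d'' η'' * padicLogPointFiniteExt ω' (W'.baseChange (v'.adicCompletion K)) p P') := by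
  intro W' _ _ p _ hp5 hadd _h4 hG K _ _ α e htab hαe v' hv' _ _ _ hp' ω' _ _ eT hμ hadd₁ hadd₂ hgal hnondeg halt hcompat hinjK hdeK d''
  have hj : 0 ≤ padicValRat p W'.j := padicValRat_j_nonneg_of_typeGOrd W' p hG
  -- (G)-ordinary ⟹ `e ∣ p − 1` ⟹ Deuring's congruence on the cell
  have hdvd := TeichmullerTwistDescent.TameExponent.semistabilityIndex_dvd_sub_one W' p hp5 hG
  unfold semistabilityIndex at hdvd
  rcases htab with ⟨h2, rfl⟩ | ⟨h3, rfl⟩ | ⟨h4, rfl⟩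
  · -- `ord = 2`, `e = 6`, `j̃ = 0`: numerology `(6; 1,1,1; 2,0; 1,0)`, `p ≡ 1 (mod 3)`
    rw [h2] at hdvd
    have hp3 : p % 3 = 1 := by
      have h6 : (12 / Nat.gcd 12 2 : ℕ) = 6 := by decide
      rw [h6] at hdvd; omega
    exact localFormula_of_ordinary_numerology_anyPrime W' p hp5 hj (e := 6) (k := 1) (m := 1) (n := 1) (r₄ := 2) (r₆ := 0) (t₄ := 1) (t₆ := 0)
      (by norm_num) (by norm_num) (by norm_num) (by norm_num) (by norm_num) (by rw [h2]) (by rw [h2]) (by norm_num) (by norm_num)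
      (Or.inr ⟨rfl, rfl, by norm_num, hp3⟩) hαe v' hv' hp' ω' eT hμ hadd₁ hadd₂ hgal hnondeg halt hcompat hinjK hdeK d''
  · -- `ord = 3`, `e = 4`, `j̃ = 1728`: numerology `(4; 1,1,2; 0,2; 0,1)`, `p ≡ 1 (mod 4)`
    rw [h3] at hdvd
    have hp4 : p % 4 = 1 := by
      have h4' : (12 / Nat.gcd 12 3 : ℕ) = 4 := by decide
      rw [h4'] at hdvd; omega
    exact localFormula_of_ordinary_numerology_anyPrime W' p hp5 hj (e := 4) (k := 1) (m := 1) (n := 2) (r₄ := 0) (r₆ := 2) (t₄ := 0) (t₆ := 1)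
      (by norm_num) (by norm_num) (by norm_num) (by norm_num) (by norm_num) (by rw [h3]) (by rw [h3]) (by norm_num) (by norm_num)
      (Or.inl ⟨rfl, rfl, by norm_num, hp4⟩) hαe v' hv' hp' ω' eT hμ hadd₁ hadd₂ hgal hnondeg halt hcompat hinjK hdeK d''
  · -- `ord = 4`, `e = 3`, `j̃ = 0`: numerology `(3; 1,2,2; 2,0; 2,0)`, `p ≡ 1 (mod 3)`
    rw [h4] at hdvd
    have hp3 : p % 3 = 1 := by
      have h3' : (12 / Nat.gcd 12 4 : ℕ) = 3 := by decide
      rw [h3'] at hdvd; omega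
    exact localFormula_of_ordinary_numerology_anyPrime W' p hp5 hj (e := 3) (k := 1) (m := 2) (n := 2) (r₄ := 2) (r₆ := 0) (t₄ := 2) (t₆ := 0)
      (by norm_num) (by norm_num) (by norm_num) (by norm_num) (by norm_num) (by rw [h4]) (by rw [h4]) (by norm_num) (by norm_num)
      (Or.inr ⟨rfl, rfl, by norm_num, hp3⟩) hαe v' hv' hp' ω' eT hμ hadd₁ hadd₂ hgal hnondeg halt hcompat hinjK hdeK d''

end Summit.BirchSwinnertonDyer.BirchSwinnertonDyer.Theorems.LocalFormulaOrdinaryAnyPrime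

end
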